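import Summits.ABC.ABC.Theses.DefiniteXi
import Literature.NumberTheory.EllipticCurves.Szpiro
import Literature.NumberTheory.EllipticCurves.SzpiroFreyConductorProofs
import Literature.NumberTheory.EllipticCurves.DegreeConjectureAbcMurtyProofs
import HarnessLib

/-!
# Stub ideation k=3, GEN 5 (family 3: PROBE THE EXTREMES) — terminal memo companion for
`stub_primeToSixDegreeBound` (P6) of `Cruxes/SteinbergCore/Lines/p6_tamagawa_split.lean`

Companion to `STUB-IDEAS-stub_primeToSixDegreeBound-3.md` (gen 5).  Gens 2–4 of this seat stand by
reference (`SketchStubIdeas3.lean` ns `…StubIdeas3`: Plans A–E, `DegLowerArch`, `SixLocal`;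
`SketchStubIdeas3G4.lean` ns `…StubIdeas3G4`: the exponent ladder `P6κ`, `LogRung`, `StubZero`,
`not_p6κ_of_neg`).  The definitions `Stub`, `P6κ`, `DegLowerArch`, `SixLocal` below are VERBATIM
copies (Cruxes workfiles are not importable modules), so every statement here is over the same Props.

GEN 5 adds ONE typed extreme, the last one the ladder left open (gen 4: `P6κ κ` false for `κ < 0`,
open on `[0, 2)`, `= Stub` at `κ = 2`):

* **G5-2 — the high-quality extreme (Mersenne family `(a, b) = (1, 2^k − 1)`, `c = 2^k`).**  On this
  family `rad(abc) ∣ 2(2^k − 1)`, so the tree facts `conductorNorm_freyCurve_dvd_holds` (`N ∣ 2⁸ rad`)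
  and `radical_natAbs_dvd_two_mul_conductorNorm_freyCurve` (`rad ∣ 2N`) pin `k < N ≤ 2⁹ H`
  (`H = max(|a|,|b|) = 2^k − 1`; `k < N` because a prime `p ∣ 2^k − 1`, `k` prime, has `ord_p 2 = k ∣ p − 1`).
  The archimedean floor `DegLowerArch θ` (gen 3; ⇐ route binder `PeterssonLowerBound` + Silverman's
  PROVED covolume inequality) then gives `deg D ≥ c_δ N^{2−δ}` for EVERY datum on the family
  (`degLower_on_mersenne`), and dividing by the six law in its subpolynomial form `SixSubexp`
  (`six(deg_min) ≤ C_η (N·H)^η`, ⇐ `SixLocal` + `ω(N) = o(log N)` by AM–GM: `sixSubexp_of_sixLocal`)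
  — consumed only in its PRIME-EXPONENT restriction `SixSubexpMersenne` (`six(deg_min) ≤ C_η 2^{ηk}`,
  `k` prime; `sixSubexpMersenne_of_sixSubexp` PROVED modulo the S-helper `mersenneConductor_le`) —
  gives `cps(deg_min) ≥ c N^{2−δ}` (`cpsLower_on_mersenne`), whence **`¬ P6κ κ` for every `κ < 2`**
  (`not_p6κ_of_lt_two`) and the calibration `P6κ κ ↔ 2 ≤ κ` given the stub (`p6κ_iff_two_le`):
  the stub's conductor exponent `2` is the sharp threshold for the prime-to-6 part as well, modulo
  the six law.  Only the LOWER bound `H ≥ N/2⁹` is used — no abc/Szpiro-type upper bound on `H`.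

* **DATA (exact `ellmoddegree`, PARI, kit j344702 / j344735; analytic cross-check j344718 / j344734:
  `deg_min = N·L(Sym²E,2)/(2π·Area)` to 20 digits on 7 rows).**  Prime-exponent rows
  `k = 5,7,11,13,17,19`: `six(deg_min) = 4,48,128,2304,768,6912` (`v₂ = 2,4,7,8,8,8`),
  `cps = 1,1,77,79,39221,53695`, `deg_min ≈ N²/2900` at `k = 17,19` (`log cps / log N = 0.85` at
  `k = 17`, above the 750-curve census maximum `0.795`) — consistent with `SixSubexpMersenne` and
  with the floor's exponent `2`.  Rows `k ≡ 0 (mod 4)` (`k = 8,12,16,20`): `cps = 1`, `six = deg_min`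
  (`= 2^24·3^3 ≈ N^{1.54}` at `k = 20`, `ω(N) = 6`) — the UNRESTRICTED `SixSubexp` and the fixed-`A`
  `SixLocal` are under stress there; decider queued: j344752 (`k = 24`, `N = 11184810`).

Every helper keeps the minimality binder and `0 < ε` where the stub has them (Disproof:
`primeToSixDegreeBound_false_without_minimality` p162897, `_false_without_eps_pos` p163062; gen-4
`not_p6κ_of_neg`); none is an instance of a landed `Negative/` lemma (p99113, p100007 concern the
ε-free / non-minimal forms).  Sorries = exactly the helpers marked (S)/(M) below; `Iff.rfl`
certificates, `p6κ_mono`, `sixSubexpMersenne_of_sixSubexp`, `not_p6κ_of_lt_two`, `p6κ_iff_two_le` are proved.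
-/
noncomputable section

set_option linter.dupNamespace false

open IsDedekindDomain WeierstrassCurve
open Literature.NumberTheory.EllipticCurves Literature.NumberTheory.EllipticCurves.ModularForms
open Literature.NumberTheory Literature.NumberTheory.DiophantineGeometry
open UniqueFactorizationMonoid

namespace Summit.ABC.ABC.Cruxes.SteinbergCore.StubIdeas3G5

/-! ## The stub and the gen-2/3/4 Props, verbatim -/

/-- The registered stub `stub_primeToSixDegreeBound`, verbatim. -/
def Stub : Prop :=
  ∀ ε : ℝ, 0 < ε → ∃ C : ℝ, ∀ a b : ℤ, IsCoprime a b → a * b * (a + b) ≠ 0 → ∀ (N : ℕ) [NeZero N],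
    (freyCurve a b).conductorNorm ℤ = N →
    ∀ D : ModularParametrizationData (freyCurve a b) N,
      (∀ D' : ModularParametrizationData (freyCurve a b) N, D.deg ≤ D'.deg) →
      ((D.deg / (ordProj[2] D.deg * ordProj[3] D.deg) : ℕ) : ℝ) ≤ C * (N : ℝ) ^ (2 + ε)

/-- Certificate: `Stub` is syntactically the registered signature (fully qualified form). -/
example : Stub ↔
    (∀ ε : ℝ, 0 < ε → ∃ C : ℝ, ∀ a b : ℤ, IsCoprime a b → a * b * (a + b) ≠ 0 → ∀ (N : ℕ) [NeZero N],
      (Literature.NumberTheory.EllipticCurves.freyCurve a b).conductorNorm ℤ = N →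
      ∀ D : Literature.NumberTheory.EllipticCurves.ModularForms.ModularParametrizationData
        (Literature.NumberTheory.EllipticCurves.freyCurve a b) N,
        (∀ D' : Literature.NumberTheory.EllipticCurves.ModularForms.ModularParametrizationData
          (Literature.NumberTheory.EllipticCurves.freyCurve a b) N, D.deg ≤ D'.deg) →
        ((D.deg / (ordProj[2] D.deg * ordProj[3] D.deg) : ℕ) : ℝ) ≤ C * (N : ℝ) ^ (2 + ε)) :=
  Iff.rfl

/-- Gen-4 `P6κ κ` verbatim: the stub with conductor exponent `κ + ε` in place of `2 + ε`. -/
def P6κ (κ : ℝ) : Prop :=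
  ∀ ε : ℝ, 0 < ε → ∃ C : ℝ, ∀ a b : ℤ, IsCoprime a b → a * b * (a + b) ≠ 0 → ∀ (N : ℕ) [NeZero N],
    (freyCurve a b).conductorNorm ℤ = N →
    ∀ D : ModularParametrizationData (freyCurve a b) N,
      (∀ D' : ModularParametrizationData (freyCurve a b) N, D.deg ≤ D'.deg) →
      ((D.deg / (ordProj[2] D.deg * ordProj[3] D.deg) : ℕ) : ℝ) ≤ C * (N : ℝ) ^ (κ + ε)

/-- The stub IS the rung `κ = 2`. -/
theorem stub_iff_p6κ_two : Stub ↔ P6κ 2 := Iff.rfl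

/-- The ladder is monotone (PROVED, gen 4 verbatim). -/
theorem p6κ_mono {κ κ' : ℝ} (hκ : κ ≤ κ') (h : P6κ κ) : P6κ κ' := by
  intro ε hε
  obtain ⟨C, hC⟩ := h ε hε
  refine ⟨max C 0, fun a b hab h0 N _ hN D hD => ?_⟩
  have h1 := hC a b hab h0 N hN D hD
  have hN1 : (1 : ℝ) ≤ (N : ℝ) := by exact_mod_cast Nat.one_le_iff_ne_zero.mpr (NeZero.ne N)
  calc ((D.deg / (ordProj[2] D.deg * ordProj[3] D.deg) : ℕ) : ℝ) ≤ C * (N : ℝ) ^ (κ + ε) := h1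
    _ ≤ max C 0 * (N : ℝ) ^ (κ + ε) :=
        mul_le_mul_of_nonneg_right (le_max_left _ _) (Real.rpow_nonneg (Nat.cast_nonneg _) _)
    _ ≤ max C 0 * (N : ℝ) ^ (κ' + ε) :=
        mul_le_mul_of_nonneg_left (Real.rpow_le_rpow_of_exponent_le hN1 (by linarith))
          (le_max_right _ _)

/-- Gen-3 `DegLowerArch θ` verbatim (abc-free, EVERY datum): `k_θ N^{1-θ} H^{1-θ} ≤ deg D`;
`⇐ PeterssonLowerBound` (route binder) + Zagier + `silverman1986_discriminant_c4_covolume_holds`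
(gen-3 `degLowerArch_of_peterssonLower`, M, not yet landed). -/
def DegLowerArch (θ : ℝ) : Prop :=
  ∃ k : ℝ, 0 < k ∧ ∀ a b : ℤ, IsCoprime a b → a * b * (a + b) ≠ 0 → ∀ (N : ℕ) [NeZero N],
    (freyCurve a b).conductorNorm ℤ = N → ∀ D : ModularParametrizationData (freyCurve a b) N,
      k * (N : ℝ) ^ (1 - θ) * (max (|(a : ℝ)|) (|(b : ℝ)|)) ^ (1 - θ) ≤ (D.deg : ℝ)

/-- Gen-3 census instrument `SixLocal` verbatim (local six law; kit j344564/j344576/j344598,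
750 curves, no violation): `six(deg_min) ≤ K A^{ω(N)} ∏_{q ∣ N} v_q(Δ_min)`. -/
def SixLocal : Prop :=
  ∃ A K : ℝ, ∀ a b : ℤ, IsCoprime a b → a * b * (a + b) ≠ 0 → ∀ (N : ℕ) [NeZero N],
    (freyCurve a b).conductorNorm ℤ = N → ∀ D : ModularParametrizationData (freyCurve a b) N,
      (∀ D' : ModularParametrizationData (freyCurve a b) N, D.deg ≤ D'.deg) →
      ((ordProj[2] D.deg * ordProj[3] D.deg : ℕ) : ℝ) ≤
        K * A ^ N.primeFactors.card *
          ((∏ q ∈ N.primeFactors, ((freyCurve a b).minimalDiscriminantNorm ℤ).factorization q : ℕ) : ℝ)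

/-! ## G5-2a — the six law in subpolynomial form -/

/-- **`SixSubexp`** (NEW helper statement, instrument-strength): the `6`-smooth part of the minimal
degree is subpolynomial in `N · H`: `six(deg_min) ≤ C_η N^η H^η` for every `η > 0`. -/
def SixSubexp : Prop :=
  ∀ η : ℝ, 0 < η → ∃ C : ℝ, ∀ a b : ℤ, IsCoprime a b → a * b * (a + b) ≠ 0 → ∀ (N : ℕ) [NeZero N],
    (freyCurve a b).conductorNorm ℤ = N → ∀ D : ModularParametrizationData (freyCurve a b) N,
      (∀ D' : ModularParametrizationData (freyCurve a b) N, D.deg ≤ D'.deg) →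
      ((ordProj[2] D.deg * ordProj[3] D.deg : ℕ) : ℝ) ≤
        C * (N : ℝ) ^ η * (max (|(a : ℝ)|) (|(b : ℝ)|)) ^ η

/-- **G5-2a (M/L, real analysis): `SixLocal ⟹ SixSubexp`** given `ω(N) = o(log N)` (Hardy–Wright
§22.10, hypothesis `hω` as in gen-3 `freyHeightBound_of_stub_of_sixLocal`).  On paper:
`v_q(Δ_min) = 2 v_q(abc)` for odd `q` (`factorization_minimalDiscriminantNorm_freyCurve_of_ne_two`),
`v_2(Δ_min) ≤ 2 v_2(abc) + 4`; AM–GM `∏_{q∣N} v_q(abc) ≤ (log|abc| / (ω log 2))^ω ≤ (3 log(2H)/ω)^ω`;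
with `ω ≤ η' log N / log log N` and `3 log H ≥ log N − 10` (`N ≤ 2⁹·2H³`) the right side is
`≤ C_η N^η H^η` (case split `log H ≶ (log N)³`; bounded `N` gives a polynomial in `log H`). [folklore] -/
theorem sixSubexp_of_sixLocal (h6 : SixLocal)
    (hω : ∀ η : ℝ, 0 < η → ∃ N₀ : ℕ, ∀ N : ℕ, N₀ ≤ N → (N.primeFactors.card : ℝ) ≤ η * Real.log N) :
    SixSubexp := by
  sorry

/-- **`SixSubexpMersenne`** (NEW, the form the composition actually consumes; data-driven restriction,
kit j344735): on the PRIME-exponent Mersenne family `(1, 2^k − 1)`, `k` prime, the `6`-smooth part of the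
minimal degree is `≤ C_η 2^{ηk}` for every `η > 0`.  Exact data (PARI `ellmoddegree`, j344702/j344735):
`six(deg_min) = 4, 48, 128, 2304, 768, 6912` at `k = 5, 7, 11, 13, 17, 19` (`v₂ = 2,4,7,8,8,8`), while
`deg_min ≈ N²/2900` at `k = 17, 19` — consistent.  CAUTION: on `k ≡ 0 (mod 4)` (`k = 8,12,16,20`)
`deg_min` is ENTIRELY `{2,3}`-smooth (`six = deg ≈ N^{1.2…1.54}`), so the unrestricted `SixSubexp` /
fixed-`A` `SixLocal` are under stress there (decider: j344752, `k = 24`). -/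
def SixSubexpMersenne : Prop :=
  ∀ η : ℝ, 0 < η → ∃ C : ℝ, ∀ k : ℕ, k.Prime → ∀ (N : ℕ) [NeZero N],
    (freyCurve 1 (2 ^ k - 1)).conductorNorm ℤ = N →
    ∀ D : ModularParametrizationData (freyCurve 1 (2 ^ k - 1)) N,
      (∀ D' : ModularParametrizationData (freyCurve 1 (2 ^ k - 1)) N, D.deg ≤ D'.deg) →
      ((ordProj[2] D.deg * ordProj[3] D.deg : ℕ) : ℝ) ≤ C * (2 : ℝ) ^ (η * k)

/-! ## G5-2 — the Mersenne family `(1, 2^k − 1, 2^k)`: the high-quality extreme -/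

/-- (S) `N(E_{1,2^k−1}) ≤ 2⁹ (2^k − 1)`: `conductorNorm_freyCurve_dvd_holds` (`N ∣ 2⁸ rad(abc)`) with
`rad((2^k − 1)·2^k) ∣ 2 (2^k − 1)`. [folklore] -/
theorem mersenneConductor_le (k : ℕ) (hk : 1 ≤ k) :
    (((freyCurve 1 (2 ^ k - 1)).conductorNorm ℤ : ℕ) : ℝ) ≤ 2 ^ 9 * ((2 : ℝ) ^ k - 1) := by
  sorry

/-- (S/M) `k < N(E_{1,2^k−1})` for `k` prime: a prime `p ∣ 2^k − 1` is odd with `orderOf (2 : ZMod p) = k`,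
so `k ∣ p − 1` (`ZMod.orderOf_dvd_card_sub_one`), and `p ∣ rad(abc) ∣ 2N`
(`radical_natAbs_dvd_two_mul_conductorNorm_freyCurve`). [folklore] -/
theorem mersenneConductor_gt (k : ℕ) (hk : k.Prime) :
    k < (freyCurve 1 (2 ^ k - 1)).conductorNorm ℤ := by
  sorry

/-- (S, PROVED modulo `mersenneConductor_le`) the unrestricted law implies the restricted one:
`N ≤ 2⁹(2^k − 1) ≤ 2^{9+k}` and `H = 2^k − 1 ≤ 2^k` turn `C N^{η/2} H^{η/2}` into `C 2^{9η/2} · 2^{ηk}`. -/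
theorem sixSubexpMersenne_of_sixSubexp (h : SixSubexp) : SixSubexpMersenne := by
  intro η hη
  have hη2 : 0 < η / 2 := by positivity
  obtain ⟨C, hC⟩ := h (η / 2) hη2
  refine ⟨max C 0 * (2 : ℝ) ^ (9 * (η / 2)), ?_⟩
  intro k hk N _ hN D hDmin
  have hk1 : 1 ≤ k := hk.one_lt.le
  have hab : IsCoprime (1 : ℤ) (2 ^ k - 1) := isCoprime_one_left
  have h2k : (1 : ℤ) ≤ 2 ^ k - 1 := by
    have : (2 : ℤ) ≤ 2 ^ k := by
      calc (2 : ℤ) = 2 ^ 1 := by norm_num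
        _ ≤ 2 ^ k := pow_le_pow_right₀ (by norm_num) hk1
    omega
  have h0 : (1 : ℤ) * (2 ^ k - 1) * (1 + (2 ^ k - 1)) ≠ 0 := by
    have h2 : (2 : ℤ) ^ k ≠ 0 := pow_ne_zero _ two_ne_zero
    have h1 : (2 : ℤ) ^ k - 1 ≠ 0 := by omega
    simpa [add_sub_cancel] using mul_ne_zero h1 h2
  have h1 := hC 1 (2 ^ k - 1) hab h0 N hN D hDmin
  -- the two size bounds, in `rpow` form with base `2`
  have h2pos : (0 : ℝ) < 2 := two_pos
  have hHle : max (|((1 : ℤ) : ℝ)|) (|((2 ^ k - 1 : ℤ) : ℝ)|) ≤ (2 : ℝ) ^ (k : ℝ) := by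
    rw [Real.rpow_natCast]
    have h2k' : (1 : ℝ) ≤ (2 : ℝ) ^ k - 1 := by exact_mod_cast h2k
    refine max_le ?_ ?_
    · simp only [Int.cast_one, abs_one]
      linarith
    · push_cast
      rw [abs_of_nonneg (by linarith)]
      linarith
  have hNle : (N : ℝ) ≤ (2 : ℝ) ^ ((9 : ℝ) + k) := by
    have hc := mersenneConductor_le k hk1
    rw [hN] at hc
    have : (2 : ℝ) ^ ((9 : ℝ) + k) = 2 ^ 9 * 2 ^ k := by
      rw [Real.rpow_add h2pos, Real.rpow_natCast]
      norm_num
    rw [this]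
    have h2k' : (2 : ℝ) ^ k - 1 ≤ 2 ^ k := by linarith
    nlinarith [h2k']
  have hN0 : (0 : ℝ) ≤ (N : ℝ) := Nat.cast_nonneg N
  have hH0 : (0 : ℝ) ≤ max (|((1 : ℤ) : ℝ)|) (|((2 ^ k - 1 : ℤ) : ℝ)|) := le_max_of_le_left (abs_nonneg _)
  -- monotonicity
  have hA : (N : ℝ) ^ (η / 2) ≤ ((2 : ℝ) ^ ((9 : ℝ) + k)) ^ (η / 2) :=
    Real.rpow_le_rpow hN0 hNle hη2.le
  have hB : (max (|((1 : ℤ) : ℝ)|) (|((2 ^ k - 1 : ℤ) : ℝ)|)) ^ (η / 2) ≤ ((2 : ℝ) ^ (k : ℝ)) ^ (η / 2) :=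
    Real.rpow_le_rpow hH0 hHle hη2.le
  have hA' : ((2 : ℝ) ^ ((9 : ℝ) + k)) ^ (η / 2) = (2 : ℝ) ^ (((9 : ℝ) + k) * (η / 2)) := by
    rw [← Real.rpow_mul h2pos.le]
  have hB' : ((2 : ℝ) ^ (k : ℝ)) ^ (η / 2) = (2 : ℝ) ^ ((k : ℝ) * (η / 2)) := by
    rw [← Real.rpow_mul h2pos.le]
  have hprod : (2 : ℝ) ^ (((9 : ℝ) + k) * (η / 2)) * (2 : ℝ) ^ ((k : ℝ) * (η / 2)) =
      (2 : ℝ) ^ (9 * (η / 2)) * (2 : ℝ) ^ (η * k) := by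
    rw [← Real.rpow_add h2pos, ← Real.rpow_add h2pos]
    congr 1; ring
  have hCle : C ≤ max C 0 := le_max_left _ _
  have hM0 : 0 ≤ max C 0 := le_max_right _ _
  calc ((ordProj[2] D.deg * ordProj[3] D.deg : ℕ) : ℝ)
      ≤ C * (N : ℝ) ^ (η / 2) * (max (|((1 : ℤ) : ℝ)|) (|((2 ^ k - 1 : ℤ) : ℝ)|)) ^ (η / 2) := h1
    _ ≤ max C 0 * (N : ℝ) ^ (η / 2) * (max (|((1 : ℤ) : ℝ)|) (|((2 ^ k - 1 : ℤ) : ℝ)|)) ^ (η / 2) := by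
        gcongr
    _ ≤ max C 0 * ((2 : ℝ) ^ ((9 : ℝ) + k)) ^ (η / 2) * ((2 : ℝ) ^ (k : ℝ)) ^ (η / 2) := by
        gcongr
    _ = max C 0 * (2 : ℝ) ^ (9 * (η / 2)) * (2 : ℝ) ^ (η * k) := by
        rw [hA', hB', mul_assoc, hprod, ← mul_assoc]

/-- **G5-2 deg level (M): the degree-conjecture exponent `2` is attained on the Mersenne family**,
for EVERY datum (no minimality, no six law): `DegLowerArch θ` at `θ = δ/2` and `H = 2^k − 1 ≥ N/2⁹`
(`mersenneConductor_le`) give `deg D ≥ k_θ N^{1−θ} (N/2⁹)^{1−θ} = c N^{2−δ}`. [folklore] -/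
theorem degLower_on_mersenne (hL : ∀ θ : ℝ, 0 < θ → DegLowerArch θ) :
    ∀ δ : ℝ, 0 < δ → ∃ c : ℝ, 0 < c ∧ ∀ k : ℕ, 1 ≤ k → ∀ (N : ℕ) [NeZero N],
      (freyCurve 1 (2 ^ k - 1)).conductorNorm ℤ = N →
      ∀ D : ModularParametrizationData (freyCurve 1 (2 ^ k - 1)) N,
        c * (N : ℝ) ^ (2 - δ) ≤ (D.deg : ℝ) := by
  sorry

/-- **G5-2 cps level (M): `cps(deg_min) ≥ c_δ N^{2−δ}` on the prime-exponent Mersenne family**, from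
`DegLowerArch` at `θ = δ/4` and `SixSubexpMersenne` at `η = δ/4`: `cps = deg / six ≥ (k_θ/C_η) N^{1−θ} H^{1−θ} 2^{−ηk}`
with `N/2⁹ ≤ H = 2^k − 1 < N·2⁰` … only the bounds `N ≤ 2⁹ H`, `H < 2^k ≤ 2N` are used
(`mersenneConductor_le`, `mersenneConductor_gt`-type facts). [folklore] -/
theorem cpsLower_on_mersenne (hL : ∀ θ : ℝ, 0 < θ → DegLowerArch θ) (h6 : SixSubexpMersenne) :
    ∀ δ : ℝ, 0 < δ → ∃ c : ℝ, 0 < c ∧ ∀ k : ℕ, k.Prime → ∀ (N : ℕ) [NeZero N],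
      (freyCurve 1 (2 ^ k - 1)).conductorNorm ℤ = N →
      ∀ D : ModularParametrizationData (freyCurve 1 (2 ^ k - 1)) N,
        (∀ D' : ModularParametrizationData (freyCurve 1 (2 ^ k - 1)) N, D.deg ≤ D'.deg) →
        c * (N : ℝ) ^ (2 - δ) ≤ ((D.deg / (ordProj[2] D.deg * ordProj[3] D.deg) : ℕ) : ℝ) := by
  sorry

/-- **G5-2 (M): no rung below `2`.**  `cpsLower_on_mersenne` at `δ = (2−κ)/3` against `P6κ κ` at
`ε = (2−κ)/3` bounds `N`, contradicting `k < N` (`mersenneConductor_gt`) for large prime `k`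
(`Nat.exists_infinite_primes`); a minimal datum at the conductor exists by `hmod` (route binder
`FreyModularity`, `isElliptic_freyCurve`, `conductorNorm_pos_holds` for `NeZero`) and `Function.argmin`
on `deg`.  PROVED from `cpsLower_on_mersenne` and `mersenneConductor_gt` (composition kernel-checked). [folklore] -/
theorem not_p6κ_of_lt_two (hL : ∀ θ : ℝ, 0 < θ → DegLowerArch θ) (h6 : SixSubexpMersenne)
    (hmod : Summit.ABC.ABC.Theses.DefiniteXi.FreyModularity) {κ : ℝ} (hκ : κ < 2) : ¬ P6κ κ := by
  intro hP
  -- the gap `δ = (2 - κ)/3 > 0`: `2 - δ = (κ + δ) + δ`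
  have hδ0 : 0 < (2 - κ) / 3 := by linarith
  obtain ⟨c, hc0, hc⟩ := cpsLower_on_mersenne hL h6 ((2 - κ) / 3) hδ0
  obtain ⟨C, hC⟩ := hP ((2 - κ) / 3) hδ0
  -- a prime `k` beyond the threshold `(C/c)^{1/δ}`
  obtain ⟨M, hM⟩ := exists_nat_gt ((C / c) ^ ((2 - κ) / 3)⁻¹)
  obtain ⟨k, hMk, hk⟩ := Nat.exists_infinite_primes (M + 1)
  have hk1 : 1 ≤ k := hk.one_lt.le
  -- the Frey inputs `(1, 2^k - 1)`
  have hab : IsCoprime (1 : ℤ) (2 ^ k - 1) := isCoprime_one_left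
  have h0 : (1 : ℤ) * (2 ^ k - 1) * (1 + (2 ^ k - 1)) ≠ 0 := by
    have h2 : (2 : ℤ) ^ k ≠ 0 := pow_ne_zero _ two_ne_zero
    have h1 : (2 : ℤ) ^ k - 1 ≠ 0 := by
      have : (2 : ℤ) ≤ 2 ^ k := by
        calc (2 : ℤ) = 2 ^ 1 := by norm_num
          _ ≤ 2 ^ k := pow_le_pow_right₀ (by norm_num) hk1
      omega
    simpa [add_sub_cancel] using mul_ne_zero h1 h2
  haveI hE : (freyCurve (1 : ℤ) (2 ^ k - 1)).IsElliptic := isElliptic_freyCurve h0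
  obtain ⟨N, hN⟩ : ∃ N : ℕ, (freyCurve (1 : ℤ) (2 ^ k - 1)).conductorNorm ℤ = N := ⟨_, rfl⟩
  have hNpos : 0 < N := by
    rw [← hN]; exact WeierstrassCurve.conductorNorm_pos_holds (freyCurve (1 : ℤ) (2 ^ k - 1))
  haveI : NeZero N := ⟨hNpos.ne'⟩
  -- a minimal datum exists (route binder `FreyModularity` + well-foundedness of `ℕ`)
  obtain ⟨D₀⟩ := hmod 1 (2 ^ k - 1) hab h0 N hN
  haveI : Nonempty (ModularParametrizationData (freyCurve (1 : ℤ) (2 ^ k - 1)) N) := ⟨D₀⟩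
  obtain ⟨D, hDmin⟩ : ∃ D : ModularParametrizationData (freyCurve (1 : ℤ) (2 ^ k - 1)) N,
      ∀ D' : ModularParametrizationData (freyCurve (1 : ℤ) (2 ^ k - 1)) N, D.deg ≤ D'.deg :=
    ⟨Function.argmin (fun D : ModularParametrizationData (freyCurve (1 : ℤ) (2 ^ k - 1)) N => D.deg),
      fun D' => Function.argmin_le
        (fun D : ModularParametrizationData (freyCurve (1 : ℤ) (2 ^ k - 1)) N => D.deg) D'⟩
  -- the two bounds at the minimal datum, and `k < N`
  have h1 := hc k hk N hN D hDmin
  have h2 := hC 1 (2 ^ k - 1) hab h0 N hN D hDmin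
  have hkN : k < N := by rw [← hN]; exact mersenneConductor_gt k hk
  -- real arithmetic: `c N^{2-δ} ≤ C N^{κ+δ}` gives `c N^δ ≤ C`, but `N > (C/c)^{1/δ}`
  have hNr : (0 : ℝ) < (N : ℝ) := by exact_mod_cast hNpos
  have hsplit : (N : ℝ) ^ (2 - (2 - κ) / 3) = (N : ℝ) ^ (κ + (2 - κ) / 3) * (N : ℝ) ^ ((2 - κ) / 3) := by
    rw [← Real.rpow_add hNr]; congr 1; ring
  have hpow : (0 : ℝ) < (N : ℝ) ^ (κ + (2 - κ) / 3) := Real.rpow_pos_of_pos hNr _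
  have h3 : c * (N : ℝ) ^ ((2 - κ) / 3) ≤ C := by
    have h12 : c * (N : ℝ) ^ ((2 - κ) / 3) * (N : ℝ) ^ (κ + (2 - κ) / 3) ≤
        C * (N : ℝ) ^ (κ + (2 - κ) / 3) := by
      calc c * (N : ℝ) ^ ((2 - κ) / 3) * (N : ℝ) ^ (κ + (2 - κ) / 3)
          = c * (N : ℝ) ^ (2 - (2 - κ) / 3) := by rw [hsplit]; ring
        _ ≤ _ := h1.trans h2
    exact le_of_mul_le_mul_right h12 hpow
  have hCc : 0 < C / c :=
    div_pos ((mul_pos hc0 (Real.rpow_pos_of_pos hNr _)).trans_le h3) hc0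
  have hNgt : (C / c) ^ ((2 - κ) / 3)⁻¹ < (N : ℝ) := by
    have hMk' : (M : ℝ) + 1 ≤ (k : ℝ) := by exact_mod_cast hMk
    have hkN' : (k : ℝ) < (N : ℝ) := by exact_mod_cast hkN
    linarith
  have h4 : C / c < (N : ℝ) ^ ((2 - κ) / 3) := by
    have := Real.rpow_lt_rpow (Real.rpow_nonneg hCc.le _) hNgt hδ0
    rwa [Real.rpow_inv_rpow hCc.le hδ0.ne'] at this
  have h5 : C < c * (N : ℝ) ^ ((2 - κ) / 3) := by
    have h6' := mul_lt_mul_of_pos_left h4 hc0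
    have hcc : c * (C / c) = C := by field_simp
    linarith
  linarith

/-- **Calibration (PROVED from the above): modulo the archimedean floor and the six law, the stub's
exponent is exactly the threshold of the ladder** — `P6κ κ ↔ 2 ≤ κ`. -/
theorem p6κ_iff_two_le (hL : ∀ θ : ℝ, 0 < θ → DegLowerArch θ) (h6 : SixSubexpMersenne)
    (hmod : Summit.ABC.ABC.Theses.DefiniteXi.FreyModularity) (hstub : Stub) (κ : ℝ) :
    P6κ κ ↔ 2 ≤ κ := by
  constructor
  · intro h
    by_contra hlt
    exact not_p6κ_of_lt_two hL h6 hmod (lt_of_not_ge hlt) h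
  · intro hκ
    exact p6κ_mono hκ (stub_iff_p6κ_two.mp hstub)

/-- Sanity: the Mersenne pairs are admissible Frey inputs (`IsCoprime 1 b`, `ab(a+b) = (2^k−1)2^k ≠ 0`). -/
example (k : ℕ) (hk : 1 ≤ k) :
    IsCoprime (1 : ℤ) (2 ^ k - 1) ∧ (1 : ℤ) * (2 ^ k - 1) * (1 + (2 ^ k - 1)) ≠ 0 := by
  refine ⟨isCoprime_one_left, ?_⟩
  have h2 : (2 : ℤ) ^ k ≠ 0 := pow_ne_zero _ two_ne_zero
  have h1 : (2 : ℤ) ^ k - 1 ≠ 0 := by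
    have : (2 : ℤ) ≤ 2 ^ k := by
      calc (2 : ℤ) = 2 ^ 1 := by norm_num
        _ ≤ 2 ^ k := pow_le_pow_right₀ (by norm_num) hk
    omega
  simpa [add_sub_cancel] using mul_ne_zero h1 h2

end Summit.ABC.ABC.Cruxes.SteinbergCore.StubIdeas3G5

end
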